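import Literature.NumberTheory.GelbartRogawski1991.DoubledWeilRepresentationAssembly
import Literature.NumberTheory.GelbartRogawski1991.DoubledWeilRepresentationFiniteHalf
import Literature.NumberTheory.GelbartRogawski1991.DoubledWeilRepresentationUndoubling
import Literature.NumberTheory.GelbartRogawski1991.DoubledWeilRepresentationLocalFamilyCM
import Literature.NumberTheory.GelbartRogawski1991.LocalUnitaryUndoubling
import Literature.NumberTheory.GelbartRogawski1991.UnitaryDualPairLocalReferenceSection
import Literature.NumberTheory.Automorphic.Liu2021.Def411WeilCarriersIrreducibleOfLocal
import Literature.NumberTheory.Automorphic.Liu2021.Def411WeilCarriersDoubling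
import Literature.NumberTheory.Automorphic.AdelicSchwartzBruhatDirectSumPure
import Literature.NumberTheory.GelbartRogawski1991.FiniteAdelicUndoubling
import Literature.NumberTheory.GelbartRogawski1991.FiniteAdelicUnitaryUndoubling
import Literature.NumberTheory.GelbartRogawski1991.DoubledWeilRepresentationUndoublingTensor
import HarnessLib

set_option Elab.async false

/-!
# Undoubling commutes with place-assembly (CARRIERS-PLAN row 9, residual (ρ1) / (H3)) — own-htheta g6

For a per-place package `𝓕 : FinLocalFamily χ 𝔪` of the doubled CM datum and ANY `sD : H(𝔸) →* Mp(𝕎^𝔻)ᶜᵒⁿᵗ` over `ι^𝔻` whose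
values on finite-adelic elements are the finite half `finHalf 𝓕` (e.g. `assemble (finHalf_isFinHalf 𝓕) ha`), the undoubled
splitting `undoubleHom sD`, read on the finite-adelic dual pair, IS the reference section `localRefSection` assembled from the
family of LOCAL undoublings `𝓕.undoubledSplittings` (GR-1's `undoubleLoc` at every place).
-/

set_option autoImplicit false

noncomputable section

open scoped Matrix Kronecker TensorProduct Classical
open NumberField IsDedekindDomain
open Literature.RepresentationTheory.HeisenbergGroup
open Literature.NumberTheory.Automorphic
open Literature.NumberTheory.Weil1964
open Literature.RepresentationTheory.HarrisKudlaSweet1996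
open Literature.NumberTheory.GaloisRepresentations

namespace Literature.NumberTheory.GelbartRogawski1991.GRConstruction

open UnitaryDualPair UnitaryDualPair.LocalSplitting UnitaryDualPair.WeilCoinv MeasureTheory

variable (L : Type) [Field L] [NumberField L] [IsCMField L]
variable {N M n : ℕ} (e : Fin N × Fin M ≃ Fin n)
  (dV : Fin N → L) (hdV : ∀ i, IsCMField.complexConj L (dV i) = dV i) (hdV0 : ∀ i, dV i ≠ 0)
  (dW : Fin M → L) (hdW : ∀ i, IsCMField.complexConj L (dW i) = dW i) (hdW0 : ∀ i, dW i ≠ 0)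
  (χ : HeckeCharacter L) (𝔪 : ∀ v, PlaceMeasure L v) (𝓕 : FinLocalFamily L e dV hdV hdV0 dW hdW hdW0 χ 𝔪)

/-! ## §1 The family of local undoublings of a per-place package (pin-1's `FinLocalSplittings.undouble` at `finSplittings 𝓕`) -/

/-- **the local undoublings of the package** `𝓕`: the doubled family `finSplittings 𝓕` undoubled place by place
(`FinLocalSplittings.undouble` of `FiniteAdelicUndoubling`) — a `FinLocalSplittings` of the UNDOUBLED big group
`U(J_{VW})`, `J_{VW} = reindex e e (diag dV ⊗ₖ diag dW) = gramR ⊗ 1`. [cite: GelbartRogawski1991, §3.1 Prop. 3.1.1 p. 455 L1–3] -/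
abbrev undoubledSplittings :
    FinLocalSplittings (Fp L) L (IsCMField.complexConj L) n (complexConj_imagUnit L) (imagUnit_ne_zero L)
      (imagUnit_mul_self L) (gramR L e dV hdV dW hdW) (gramR_isSymm L e dV hdV dW hdW)
      (J := Matrix.reindex e e (Matrix.diagonal dV ⊗ₖ Matrix.diagonal dW))
      (reindex_kronecker_eq_gram_map (Fp L) L e (realDiagonal_map L dV hdV).symm (realDiagonal_map L dW hdW).symm) :=
  (finSplittings L e dV hdV hdV0 dW hdW hdW0 χ 𝔪 𝓕).undouble
    (reindex_kronecker_eq_gram_map (Fp L) L e (realDiagonal_map L dV hdV).symm (realDiagonal_map L dW hdW).symm)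
    (gramR_isSymm L e dV hdV dW hdW) (isUnit_det_gramR₀ L e dV hdV hdV0 dW hdW hdW0)

/-! ## §2 The standard place-pure test vector -/

/-- the base family `(1_{𝒪_v^ι})_v` as a restricted family (the coset family of `0 + 𝒪̂^ι`). [cite: Weil1964, Chap. III n° 37–38 pp. 188–190] -/
def baseFamily (ι : Type) [Fintype ι] : LocalSBFamily (Fp L) ι :=
  cosetFamily (Fp L) ι (𝔫 := ⊤) (by simp) 0

omit [IsCMField L] in
/-- `∏_v 1_{𝒪_v^ι}` takes the value `1` at `0`. [cite: Weil1964, Chap. III n° 37–38 pp. 188–190] -/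
theorem piProd_baseFamily_zero (ι : Type) [Fintype ι] : piProd (Fp L) ι (baseFamily L ι) 0 = 1 :=
  piProd_cosetFamily_of_mem (Fp L) ι _ (by rw [sub_zero]; exact zero_mem _)

/-- the standard test vector `Φ₀ = unitSchwartz ⊗ ∏_v 1_{𝒪_v^ι} ∈ 𝒮(𝔸^ι)`. [cite: Weil1964, Chap. III n° 37–38 pp. 188–190] -/
def stdVec (ι : Type) [Fintype ι] : piSchwartzBruhat (Fp L) ι :=
  piSchwartzBruhatEquiv (Fp L) ι (unitSchwartz (Fp L) ι ⊗ₜ piProdSB (Fp L) ι (baseFamily L ι))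

omit [IsCMField L] in
/-- `Φ₀(0) = 1`. [cite: Weil1964, Chap. III n° 37–38 pp. 188–190] -/
theorem stdVec_apply_zero (ι : Type) [Fintype ι] :
    ((stdVec L ι : piSchwartzBruhat (Fp L) ι) : (ι → AdeleRing (𝓞 (Fp L)) (Fp L)) → ℂ) 0 = 1 := by
  rw [stdVec, coe_piSchwartzBruhatEquiv_tmul]
  dsimp only
  rw [coe_piProdSB, piArch_zero, piFinite_zero, unitSchwartz_apply_zero, piProd_baseFamily_zero, one_mul]

omit [IsCMField L] in
/-- `Φ₀ ≠ 0`. [cite: Weil1964, Chap. III n° 37–38 pp. 188–190] -/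
theorem stdVec_ne_zero (ι : Type) [Fintype ι] : stdVec L ι ≠ 0 := fun h => by
  have h1 := stdVec_apply_zero L ι
  rw [h, ZeroMemClass.coe_zero, Pi.zero_apply] at h1
  exact zero_ne_one h1

/-! ## §3 The square, from the product formula on place-pure tensors -/

variable {sD : HA L e dV hdV dW hdW →* MpD L e dV hdV dW hdW}
  (hsD : IsDoubledWeilRep L e dV hdV hdV0 dW hdW hdW0 χ sD)

/-- **THE PRODUCT FORMULA ON PLACE-PURE TENSORS** (statement; the content of (H3-L1)+(H3-L2)+(H3-L3) with `hfin`): for a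
finite-adelic pair element `(k, u)`, `g̃ = a(1,k)·b(1,u) ∈ G₁(𝔸)`, `g' = reindex e e (k ⊗ u) ∈ U(J_{VW})(𝔸_f)`,
`ω(u^𝔻(g̃)) ((a₁ ⊗ ∏φ₁) ⊠ (a₂ ⊗ ∏φ₂)) = (a₁ ⊗ Ω(g')∏φ₁) ⊠ (a₂ ⊗ ∏φ₂)` with `Ω` the place-assembled Weil representation of
the local undoublings. [cite: GelbartRogawski1991, §3.1 Prop. 3.1.1 p. 455 L1–3] -/
def ProductFormula (sD : HA L e dV hdV dW hdW →* MpD L e dV hdV dW hdW) : Prop :=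
  ∀ (k : UnitaryGroup.finAdelic (Fp L) L (IsCMField.complexConj L) N (Matrix.diagonal dV))
    (u : UnitaryGroup.finAdelic (Fp L) L (IsCMField.complexConj L) M (Matrix.diagonal dW))
    (a₁ a₂ : SchwartzMap (Fin n → mixedEmbedding.mixedSpace (Fp L)) ℂ) (φ₁ φ₂ : LocalSBFamily (Fp L) (Fin n)),
    adelicMpCont.omega (Fp L) (Fin n ⊕ Fin n) (gramS L e dV hdV dW hdW)
        (uD L e dV hdV dW hdW sD
          (UnitaryGroup.adelicInl (Fp L) L (IsCMField.complexConj L) N M (Matrix.diagonal dV) (Matrix.diagonal dW)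
              (UnitaryGroup.finAdelicToAdelic (Fp L) L (IsCMField.complexConj L) N (Matrix.diagonal dV) k) *
            UnitaryGroup.adelicInr (Fp L) L (IsCMField.complexConj L) N M (Matrix.diagonal dV) (Matrix.diagonal dW)
              (UnitaryGroup.finAdelicToAdelic (Fp L) L (IsCMField.complexConj L) M (Matrix.diagonal dW) u)))
        (tensorToSum (Fp L) (Fin n) (Fin n)
          (piSchwartzBruhatEquiv (Fp L) (Fin n) (a₁ ⊗ₜ piProdSB (Fp L) (Fin n) φ₁))
          (piSchwartzBruhatEquiv (Fp L) (Fin n) (a₂ ⊗ₜ piProdSB (Fp L) (Fin n) φ₂))) =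
      tensorToSum (Fp L) (Fin n) (Fin n)
        (piSchwartzBruhatEquiv (Fp L) (Fin n) (a₁ ⊗ₜ
          (undoubledSplittings L e dV hdV hdV0 dW hdW hdW0 χ 𝔪 𝓕).Omega
            (UnitaryGroup.finPairEmb (Fp L) L (IsCMField.complexConj L) N M e (Matrix.diagonal dV) (Matrix.diagonal dW) (k, u))
            (piProdSB (Fp L) (Fin n) φ₁)))
        (piSchwartzBruhatEquiv (Fp L) (Fin n) (a₂ ⊗ₜ piProdSB (Fp L) (Fin n) φ₂))

set_option maxHeartbeats 2000000 in
include hsD in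
/-- **ω of the undoubled splitting on the standard vector**, from the product formula: for `g̃ = a(1,k)·b(1,u)`,
`ω(s(g̃)) Φ₀ = unitSchwartz ⊗ Ω(reindex (k ⊗ u)) ∏_v 1_{𝒪_vⁿ}` (`s = undoubleHom sD`; evaluate the product formula at
`Φ₁ = Φ₂ = Φ₀` and read the `inl`-slice at `(x, 0)`, `Φ₀(0) = 1`). [cite: GelbartRogawski1991, §3.1 Prop. 3.1.1 p. 455 L1–3] -/
theorem omega_undouble_stdVec (hP : ProductFormula L e dV hdV hdV0 dW hdW hdW0 χ 𝔪 𝓕 sD)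
    (k : UnitaryGroup.finAdelic (Fp L) L (IsCMField.complexConj L) N (Matrix.diagonal dV))
    (u : UnitaryGroup.finAdelic (Fp L) L (IsCMField.complexConj L) M (Matrix.diagonal dW)) :
    adelicMpCont.omega (Fp L) (Fin n) (gramA L e dV hdV dW hdW)
        (undouble L e dV hdV hdV0 dW hdW hdW0 hsD.proj_eq
          (UnitaryGroup.adelicInl (Fp L) L (IsCMField.complexConj L) N M (Matrix.diagonal dV) (Matrix.diagonal dW)
              (UnitaryGroup.finAdelicToAdelic (Fp L) L (IsCMField.complexConj L) N (Matrix.diagonal dV) k) *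
            UnitaryGroup.adelicInr (Fp L) L (IsCMField.complexConj L) N M (Matrix.diagonal dV) (Matrix.diagonal dW)
              (UnitaryGroup.finAdelicToAdelic (Fp L) L (IsCMField.complexConj L) M (Matrix.diagonal dW) u)))
        (stdVec L (Fin n)) =
      piSchwartzBruhatEquiv (Fp L) (Fin n) (unitSchwartz (Fp L) (Fin n) ⊗ₜ
        (undoubledSplittings L e dV hdV hdV0 dW hdW hdW0 χ 𝔪 𝓕).Omega
          (UnitaryGroup.finPairEmb (Fp L) L (IsCMField.complexConj L) N M e (Matrix.diagonal dV) (Matrix.diagonal dW) (k, u))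
          (piProdSB (Fp L) (Fin n) (baseFamily L (Fin n)))) := by
  apply Subtype.ext
  funext x
  -- the product formula at `Φ₁ = Φ₂ = Φ₀`, read at `(x, 0)`
  have h1 := congrArg (fun Ψ : piSchwartzBruhat (Fp L) (Fin n ⊕ Fin n) => (Ψ : (Fin n ⊕ Fin n → AdeleRing (𝓞 (Fp L)) (Fp L)) → ℂ) (Sum.elim x 0))
    (omega_uD_tensorToSum L e dV hdV hdV0 dW hdW hdW0 hsD.proj_eq
      (UnitaryGroup.adelicInl (Fp L) L (IsCMField.complexConj L) N M (Matrix.diagonal dV) (Matrix.diagonal dW)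
          (UnitaryGroup.finAdelicToAdelic (Fp L) L (IsCMField.complexConj L) N (Matrix.diagonal dV) k) *
        UnitaryGroup.adelicInr (Fp L) L (IsCMField.complexConj L) N M (Matrix.diagonal dV) (Matrix.diagonal dW)
          (UnitaryGroup.finAdelicToAdelic (Fp L) L (IsCMField.complexConj L) M (Matrix.diagonal dW) u))
      (stdVec L (Fin n)) (stdVec L (Fin n)))
  have h2 := congrArg (fun Ψ : piSchwartzBruhat (Fp L) (Fin n ⊕ Fin n) => (Ψ : (Fin n ⊕ Fin n → AdeleRing (𝓞 (Fp L)) (Fp L)) → ℂ) (Sum.elim x 0))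
    (hP k u (unitSchwartz (Fp L) (Fin n)) (unitSchwartz (Fp L) (Fin n)) (baseFamily L (Fin n)) (baseFamily L (Fin n)))
  have h0 : ((stdVec L (Fin n) : piSchwartzBruhat (Fp L) (Fin n)) : (Fin n → AdeleRing (𝓞 (Fp L)) (Fp L)) → ℂ) 0 = 1 :=
    stdVec_apply_zero L (Fin n)
  have h3 := h1.symm.trans h2
  simp only [coe_tensorToSum, boxTensor_apply, Sum.elim_inl, Sum.elim_inr] at h3
  -- `h3 : A x' * Φ₀ 0' = B x' * Φ₀ 0'` with `x' = fun i => x i`, `0' = fun j => 0`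
  have h0a : ((stdVec L (Fin n) : piSchwartzBruhat (Fp L) (Fin n)) : (Fin n → AdeleRing (𝓞 (Fp L)) (Fp L)) → ℂ)
      (fun j => (0 : Fin n → AdeleRing (𝓞 (Fp L)) (Fp L)) j) = 1 := h0
  have h0b := h0a
  rw [stdVec] at h0b
  have h4 := h3
  simp only [Pi.zero_apply] at h4 h0a h0b
  rw [h0a, h0b, mul_one, mul_one] at h4
  exact h4

/-! ## §4 The square from the product formula (twist-and-one-vector) -/

set_option maxHeartbeats 8000000 in
include hsD in
/-- **UNDOUBLING COMMUTES WITH PLACE-ASSEMBLY, given the product formula on place-pure tensors.**  The undoubled splitting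
`s = undoubleHom sD` read on the finite-adelic dual pair and the reference section `s₀` assembled from the local undoublings lie
over the same symplectic map, hence differ by a continuous character `η` (`exists_twist_localRefSection_continuous`); on the test
vector `Φ₀` both give `unitSchwartz ⊗ Ω(reindex (k ⊗ u)) ∏_v 1_{𝒪_vⁿ}` (`omega_undouble_stdVec` ∕ `omega_finSplitting_tmul`), so
`η = 1`. [cite: GelbartRogawski1991, §3.1 Prop. 3.1.1 p. 455 L1–3, Remark p. 457 L4–13] -/
theorem pairSmall₁_undoubleHom_eq_localRefSection_of_productFormula
    (hP : ProductFormula L e dV hdV hdV0 dW hdW hdW0 χ 𝔪 𝓕 sD) :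
    (pairSmall₁ (Fp L) L (IsCMField.complexConj L) N M e (Matrix.diagonal dV) (Matrix.diagonal dW)
        (undoubleHom L e dV hdV hdV0 dW hdW hdW0 sD hsD.proj_eq)).comp
      (finPairToAdelic (Fp L) L (IsCMField.complexConj L) N M (Matrix.diagonal dV) (Matrix.diagonal dW)) =
    localRefSection (Fp L) L (IsCMField.complexConj L) N M e (Matrix.diagonal dV) (Matrix.diagonal dW)
      (complexConj_imagUnit L) (imagUnit_ne_zero L) (imagUnit_mul_self L) (realDiagonal_isSymm L dV hdV)
      (realDiagonal_isSymm L dW hdW) (realDiagonal_map L dV hdV).symm (realDiagonal_map L dW hdW).symm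
      (undoubledSplittings L e dV hdV hdV0 dW hdW hdW0 χ 𝔪 𝓕) := by
  have hs := Literature.NumberTheory.Automorphic.Liu2021.Def411WeilCarriersDoubling.isCompatible_undoubleHom L e dV hdV hdV0 dW hdW hdW0 χ hsD
  have hsc := Literature.NumberTheory.Automorphic.Liu2021.Def411WeilCarriersDoubling.continuous_pairSplitting_undoubleHom
    L e dV hdV hdV0 dW hdW hdW0 hsD.continuous hsD.proj_eq
  obtain ⟨η, -, hη⟩ := exists_twist_localRefSection_continuous (Fp L) L (IsCMField.complexConj L) N M e
    (Matrix.diagonal dV) (Matrix.diagonal dW) (complexConj_imagUnit L) (imagUnit_ne_zero L) (imagUnit_mul_self L)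
    (realDiagonal_isSymm L dV hdV) (realDiagonal_isSymm L dW hdW) (isUnit_det_realDiagonal L dV hdV hdV0)
    (isUnit_det_realDiagonal L dW hdW hdW0) (realDiagonal_map L dV hdV).symm (realDiagonal_map L dW hdW).symm
    (undoubledSplittings L e dV hdV hdV0 dW hdW hdW0 χ 𝔪 𝓕) hs hsc
  have hη1 : η = 1 := by
    refine MonoidHom.ext fun p => ?_
    obtain ⟨k, u⟩ := p
    have hΨ₀ : (piSBReindex (Fp L) e).symm (stdVec L (Fin n)) ≠ 0 :=
      ((piSBReindex (Fp L) e).symm.map_ne_zero_iff).2 (stdVec_ne_zero L (Fin n))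
    -- left: the undoubled splitting on `Ψ₀ = R_e⁻¹ Φ₀`
    have hL : adelicMpCont.omega (Fp L) (Fin N × Fin M) _
        (((pairSmall₁ (Fp L) L (IsCMField.complexConj L) N M e (Matrix.diagonal dV) (Matrix.diagonal dW)
            (undoubleHom L e dV hdV hdV0 dW hdW hdW0 sD hsD.proj_eq)).comp
          (finPairToAdelic (Fp L) L (IsCMField.complexConj L) N M (Matrix.diagonal dV) (Matrix.diagonal dW))) (k, u))
        ((piSBReindex (Fp L) e).symm (stdVec L (Fin n))) =
      (piSBReindex (Fp L) e).symm (piSchwartzBruhatEquiv (Fp L) (Fin n) (unitSchwartz (Fp L) (Fin n) ⊗ₜ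
        (undoubledSplittings L e dV hdV hdV0 dW hdW hdW0 χ 𝔪 𝓕).Omega
          (UnitaryGroup.finPairEmb (Fp L) L (IsCMField.complexConj L) N M e (Matrix.diagonal dV) (Matrix.diagonal dW) (k, u))
          (piProdSB (Fp L) (Fin n) (baseFamily L (Fin n))))) := by
      show adelicMpCont.omega (Fp L) (Fin N × Fin M) _
          ((adelicMpContReindex (Fp L) e _).symm
            (pairSplitting (Fp L) L (IsCMField.complexConj L) N M e (Matrix.diagonal dV) (Matrix.diagonal dW)
              (undoubleHom L e dV hdV hdV0 dW hdW hdW0 sD hsD.proj_eq)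
              (UnitaryGroup.finAdelicToAdelic (Fp L) L (IsCMField.complexConj L) N (Matrix.diagonal dV) k,
                UnitaryGroup.finAdelicToAdelic (Fp L) L (IsCMField.complexConj L) M (Matrix.diagonal dW) u)))
          ((piSBReindex (Fp L) e).symm (stdVec L (Fin n))) = _
      rw [adelicMpCont.omega_reindex_symm_apply, (piSBReindex (Fp L) e).apply_symm_apply, pairSplitting_apply,
        undoubleHom_apply, omega_undouble_stdVec L e dV hdV hdV0 dW hdW hdW0 χ 𝔪 𝓕 hsD hP k u]
    -- right: the reference section on `Ψ₀`
    have hR : adelicMpCont.omega (Fp L) (Fin N × Fin M) _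
        (localRefSection (Fp L) L (IsCMField.complexConj L) N M e (Matrix.diagonal dV) (Matrix.diagonal dW)
          (complexConj_imagUnit L) (imagUnit_ne_zero L) (imagUnit_mul_self L) (realDiagonal_isSymm L dV hdV)
          (realDiagonal_isSymm L dW hdW) (realDiagonal_map L dV hdV).symm (realDiagonal_map L dW hdW).symm
          (undoubledSplittings L e dV hdV hdV0 dW hdW hdW0 χ 𝔪 𝓕) (k, u))
        ((piSBReindex (Fp L) e).symm (stdVec L (Fin n))) =
      (piSBReindex (Fp L) e).symm (piSchwartzBruhatEquiv (Fp L) (Fin n) (unitSchwartz (Fp L) (Fin n) ⊗ₜ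
        (undoubledSplittings L e dV hdV hdV0 dW hdW hdW0 χ 𝔪 𝓕).Omega
          (UnitaryGroup.finPairEmb (Fp L) L (IsCMField.complexConj L) N M e (Matrix.diagonal dV) (Matrix.diagonal dW) (k, u))
          (piProdSB (Fp L) (Fin n) (baseFamily L (Fin n))))) := by
      rw [omega_localRefSection_apply, (piSBReindex (Fp L) e).apply_symm_apply,
        omega_relabel_finSplitting_apply (Fp L) L (IsCMField.complexConj L) N M e (Matrix.diagonal dV) (Matrix.diagonal dW)
          (complexConj_imagUnit L) (imagUnit_ne_zero L) (imagUnit_mul_self L) (realDiagonal_isSymm L dV hdV)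
          (realDiagonal_isSymm L dW hdW) (realDiagonal_map L dV hdV).symm (realDiagonal_map L dW hdW).symm
          (undoubledSplittings L e dV hdV hdV0 dW hdW hdW0 χ 𝔪 𝓕),
        stdVec, FinLocalSplittings.omega_finSplitting_tmul]
      exact rfl
    have htw := (hL.symm.trans
      (adelicMpCont.omega_eq_smul_of_eq_twist hη (k, u) ((piSBReindex (Fp L) e).symm (stdVec L (Fin n))))).trans
      (congrArg (fun Ψ => ((η (k, u) : ℂˣ) : ℂ) • Ψ) hR)
    have hne : (piSBReindex (Fp L) e).symm (piSchwartzBruhatEquiv (Fp L) (Fin n) (unitSchwartz (Fp L) (Fin n) ⊗ₜ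
        (undoubledSplittings L e dV hdV hdV0 dW hdW hdW0 χ 𝔪 𝓕).Omega
          (UnitaryGroup.finPairEmb (Fp L) L (IsCMField.complexConj L) N M e (Matrix.diagonal dV) (Matrix.diagonal dW) (k, u))
          (piProdSB (Fp L) (Fin n) (baseFamily L (Fin n))))) ≠ 0 := by
      rw [← hR]; exact adelicMpCont.omega_apply_ne_zero _ hΨ₀
    have h1 : ((η (k, u) : ℂˣ) : ℂ) = 1 :=
      (smul_left_injective ℂ hne ((htw.symm).trans (one_smul ℂ _).symm))
    exact Units.ext h1
  rw [hη, hη1]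
  exact MonoidHom.ext fun p => adelicMpCont.twist_eq_of_eq_one _ (1 : _ →* ℂˣ) rfl

/-! ## §5 The product formula for an `sD` whose finite-adelic values are the finite half; the square -/

variable (hfin : ∀ h : UnitaryGroup.finAdelic (Fp L) L (IsCMField.complexConj L) (n + n) (hermD L e dV hdV dW hdW),
    sD (UnitaryGroup.finAdelicToAdelic (Fp L) L (IsCMField.complexConj L) (n + n) (hermD L e dV hdV dW hdW) h) =
      finHalf L e dV hdV hdV0 dW hdW hdW0 χ 𝔪 𝓕 h)

set_option maxHeartbeats 4000000 in
include hfin in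
/-- **THE PRODUCT FORMULA** for an `sD` that is the finite half `finHalf 𝓕` on finite-adelic elements: on `g̃ = a(1,k)·b(1,u)`,
`sD (inlG g̃) = s_f (inlFin (reindex (k ⊗ u)))` (`inlG_adelicInl_mul_adelicInr_finAdelicToAdelic` + `hfin`), whose operator is
`1 ⊗ Ω^𝔻(inlFin g')` (`omega_finHalf_eq_adelicTensorEnd`); `Ω^𝔻(inlFin g') (f₁ ⊠_f f₂) = (Ω(g') f₁) ⊠_f f₂` by the place-assembled
undoubling identity (`FinLocalSplittings.Omega_boxFin_of_evalPlace_eq` at `evalPlace_inlFin`); fold back through `undoubleIdx`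
(`omega_uD_tensorToSum_tmul_eq_tensorToSum`). [cite: GelbartRogawski1991, §3.1 Prop. 3.1.1 p. 455 L1–3; Weil1964, Chap. III n° 37–38 pp. 188–190] -/
theorem productFormula_of_finHalf : ProductFormula L e dV hdV hdV0 dW hdW hdW0 χ 𝔪 𝓕 sD := by
  intro k u a₁ a₂ φ₁ φ₂
  have hB : (adelicMpCont.omega (Fp L) (Fin (n + n)) (gramDA L e dV hdV dW hdW)
        (sD (inlG L e dV hdV dW hdW
          (UnitaryGroup.adelicInl (Fp L) L (IsCMField.complexConj L) N M (Matrix.diagonal dV) (Matrix.diagonal dW)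
              (UnitaryGroup.finAdelicToAdelic (Fp L) L (IsCMField.complexConj L) N (Matrix.diagonal dV) k) *
            UnitaryGroup.adelicInr (Fp L) L (IsCMField.complexConj L) N M (Matrix.diagonal dV) (Matrix.diagonal dW)
              (UnitaryGroup.finAdelicToAdelic (Fp L) L (IsCMField.complexConj L) M (Matrix.diagonal dW) u)))) :
        piSchwartzBruhat (Fp L) (Fin (n + n)) →ₗ[ℂ] piSchwartzBruhat (Fp L) (Fin (n + n))) =
      adelicTensorEnd LinearMap.id ((finSplittings L e dV hdV hdV0 dW hdW hdW0 χ 𝔪 𝓕).Omega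
        (inlFin (Fp L) L (IsCMField.complexConj L) n
          (reindex_kronecker_eq_gram_map (Fp L) L e (realDiagonal_map L dV hdV).symm (realDiagonal_map L dW hdW).symm)
          (hermD_eq_map_gramD L e dV hdV dW hdW)
          (UnitaryGroup.finPairEmb (Fp L) L (IsCMField.complexConj L) N M e (Matrix.diagonal dV) (Matrix.diagonal dW) (k, u)))) := by
    rw [inlG_adelicInl_mul_adelicInr_finAdelicToAdelic L e dV hdV dW hdW k u, hfin]
    exact omega_finHalf_eq_adelicTensorEnd L e dV hdV hdV0 dW hdW hdW0 χ 𝔪 𝓕 _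
  have hBf := (finSplittings L e dV hdV hdV0 dW hdW hdW0 χ 𝔪 𝓕).Omega_boxFin_of_evalPlace_eq_undouble
    (reindex_kronecker_eq_gram_map (Fp L) L e (realDiagonal_map L dV hdV).symm (realDiagonal_map L dW hdW).symm)
    (gramR_isSymm L e dV hdV dW hdW) (isUnit_det_gramR₀ L e dV hdV hdV0 dW hdW hdW0)
    (UnitaryGroup.finPairEmb (Fp L) L (IsCMField.complexConj L) N M e (Matrix.diagonal dV) (Matrix.diagonal dW) (k, u))
    (inlFin (Fp L) L (IsCMField.complexConj L) n
      (reindex_kronecker_eq_gram_map (Fp L) L e (realDiagonal_map L dV hdV).symm (realDiagonal_map L dW hdW).symm)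
      (hermD_eq_map_gramD L e dV hdV dW hdW)
      (UnitaryGroup.finPairEmb (Fp L) L (IsCMField.complexConj L) N M e (Matrix.diagonal dV) (Matrix.diagonal dW) (k, u)))
    (fun v => evalPlace_inlFin (Fp L) L (IsCMField.complexConj L) n
      (reindex_kronecker_eq_gram_map (Fp L) L e (realDiagonal_map L dV hdV).symm (realDiagonal_map L dW hdW).symm)
      (hermD_eq_map_gramD L e dV hdV dW hdW) v _)
    (piProdSB (Fp L) (Fin n) φ₁) (piProdSB (Fp L) (Fin n) φ₂)
  exact omega_uD_tensorToSum_tmul_eq_tensorToSum L e dV hdV dW hdW sD _ hB a₁ a₂ hBf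

include hsD hfin in
/-- **UNDOUBLING COMMUTES WITH PLACE-ASSEMBLY** (CARRIERS-PLAN row 9, residual (ρ1), step (H3)): for a per-place package `𝓕` of
the doubled CM datum and ANY `χ`-normalised doubled Weil representation `sD` whose values on finite-adelic elements are the finite half
`finHalf 𝓕` (e.g. `assemble (finHalf_isFinHalf 𝓕) ha`), the undoubled splitting `undoubleHom sD`, read on the finite-adelic dual pair
`U(diag dV)(𝔸_f) × U(diag dW)(𝔸_f)`, IS the reference section `localRefSection` assembled from the LOCAL undoublings of `𝓕`.
[cite: GelbartRogawski1991, §3.1 Prop. 3.1.1 p. 455 L1–3, Remark p. 457 L4–13] -/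
theorem pairSmall₁_undoubleHom_finPairToAdelic_eq_localRefSection :
    (pairSmall₁ (Fp L) L (IsCMField.complexConj L) N M e (Matrix.diagonal dV) (Matrix.diagonal dW)
        (undoubleHom L e dV hdV hdV0 dW hdW hdW0 sD hsD.proj_eq)).comp
      (finPairToAdelic (Fp L) L (IsCMField.complexConj L) N M (Matrix.diagonal dV) (Matrix.diagonal dW)) =
    localRefSection (Fp L) L (IsCMField.complexConj L) N M e (Matrix.diagonal dV) (Matrix.diagonal dW)
      (complexConj_imagUnit L) (imagUnit_ne_zero L) (imagUnit_mul_self L) (realDiagonal_isSymm L dV hdV)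
      (realDiagonal_isSymm L dW hdW) (realDiagonal_map L dV hdV).symm (realDiagonal_map L dW hdW).symm
      (undoubledSplittings L e dV hdV hdV0 dW hdW hdW0 χ 𝔪 𝓕) :=
  pairSmall₁_undoubleHom_eq_localRefSection_of_productFormula L e dV hdV hdV0 dW hdW hdW0 χ 𝔪 𝓕 hsD
    (productFormula_of_finHalf L e dV hdV hdV0 dW hdW hdW0 χ 𝔪 𝓕 hfin)

/-- the assembled doubled splitting `assemble hf ha` IS a `χ`-normalised doubled Weil representation (the record of
`isDoubledWeilRep_of_halves`, `∃`-free). [cite: HarrisKudlaSweet1996, §1 (1.11)–(1.16)] -/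
theorem isDoubledWeilRep_assemble
    {sf : UnitaryGroup.finAdelic (Fp L) L (IsCMField.complexConj L) (n + n) (hermD L e dV hdV dW hdW) →* MpD L e dV hdV dW hdW}
    {sa : UnitaryGroup.arch (Fp L) L (IsCMField.complexConj L) (n + n) (hermD L e dV hdV dW hdW) →* MpD L e dV hdV dW hdW}
    (hf : IsFinHalf L e dV hdV hdV0 dW hdW hdW0 χ sf) (ha : IsArchHalf L e dV hdV hdV0 dW hdW hdW0 χ sa) :
    IsDoubledWeilRep L e dV hdV hdV0 dW hdW hdW0 χ (assemble L e dV hdV hdV0 dW hdW hdW0 hf ha) :=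
  { continuous := S1asm_continuous L e dV hdV hdV0 dW hdW hdW0 hf ha
    proj_eq := proj_assemble L e dV hdV hdV0 dW hdW hdW0 hf ha
    parabolic := S1asm_parabolic L e dV hdV hdV0 dW hdW hdW0 hf ha }

/-- **the square for the ASSEMBLED doubled Weil representation of the package** `sD := assemble (finHalf 𝓕) sa`
(`IsDoubledWeilRep` by `isDoubledWeilRep_assemble`; `hfin` by `assemble_finAdelicToAdelic`).
[cite: GelbartRogawski1991, §3.1 Prop. 3.1.1 p. 455 L1–3] -/
theorem pairSmall₁_undoubleHom_assemble_finPairToAdelic_eq_localRefSection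
    {sa : UnitaryGroup.arch (Fp L) L (IsCMField.complexConj L) (n + n) (hermD L e dV hdV dW hdW) →* MpD L e dV hdV dW hdW}
    (ha : IsArchHalf L e dV hdV hdV0 dW hdW hdW0 χ sa) :
    (pairSmall₁ (Fp L) L (IsCMField.complexConj L) N M e (Matrix.diagonal dV) (Matrix.diagonal dW)
        (undoubleHom L e dV hdV hdV0 dW hdW hdW0 (assemble L e dV hdV hdV0 dW hdW hdW0 (finHalf_isFinHalf L e dV hdV hdV0 dW hdW hdW0 χ 𝔪 𝓕) ha)
          (isDoubledWeilRep_assemble L e dV hdV hdV0 dW hdW hdW0 χ (finHalf_isFinHalf L e dV hdV hdV0 dW hdW hdW0 χ 𝔪 𝓕) ha).proj_eq)).comp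
      (finPairToAdelic (Fp L) L (IsCMField.complexConj L) N M (Matrix.diagonal dV) (Matrix.diagonal dW)) =
    localRefSection (Fp L) L (IsCMField.complexConj L) N M e (Matrix.diagonal dV) (Matrix.diagonal dW)
      (complexConj_imagUnit L) (imagUnit_ne_zero L) (imagUnit_mul_self L) (realDiagonal_isSymm L dV hdV)
      (realDiagonal_isSymm L dW hdW) (realDiagonal_map L dV hdV).symm (realDiagonal_map L dW hdW).symm
      (undoubledSplittings L e dV hdV hdV0 dW hdW hdW0 χ 𝔪 𝓕) :=
  pairSmall₁_undoubleHom_finPairToAdelic_eq_localRefSection L e dV hdV hdV0 dW hdW hdW0 χ 𝔪 𝓕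
    (isDoubledWeilRep_assemble L e dV hdV hdV0 dW hdW hdW0 χ (finHalf_isFinHalf L e dV hdV hdV0 dW hdW hdW0 χ 𝔪 𝓕) ha)
    (assemble_finAdelicToAdelic L e dV hdV dW hdW hdV0 hdW0 (finHalf_isFinHalf L e dV hdV hdV0 dW hdW hdW0 χ 𝔪 𝓕) ha)

/-! ## §6 Transport to the consumers' W-side Gram data `T_W`, `J_W` (`dW := lineW T_W`; `subst`-class) -/

section Transport

variable {TW' : Matrix (Fin M) (Fin M) (Fp L)} {JW' : Matrix (Fin M) (Fin M) L}

/-- **transport of a `FinLocalSplittings` of `U(J_V ⊗ J_W)` along equal W-side Gram data** `realDiagonal dW = T_W'`,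
`diagonal dW = J_W'` (the structure's type depends on them through `gram e T_V T_W` and `reindex e e (J_V ⊗ₖ J_W)`).
[cite: GelbartRogawski1991, §3.1 Prop. 3.1.1 p. 455 L1–3] -/
def congrW (hT : realDiagonal L dW hdW = TW') (hJ : Matrix.diagonal dW = JW')
    (𝓢 : FinLocalSplittings (Fp L) L (IsCMField.complexConj L) n (complexConj_imagUnit L) (imagUnit_ne_zero L)
      (imagUnit_mul_self L) (gramR L e dV hdV dW hdW) (gramR_isSymm L e dV hdV dW hdW)
      (J := Matrix.reindex e e (Matrix.diagonal dV ⊗ₖ Matrix.diagonal dW))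
      (reindex_kronecker_eq_gram_map (Fp L) L e (realDiagonal_map L dV hdV).symm (realDiagonal_map L dW hdW).symm))
    (hW' : TW'.IsSymm) (hJW' : JW' = TW'.map (algebraMap (Fp L) L)) :
    FinLocalSplittings (Fp L) L (IsCMField.complexConj L) n (complexConj_imagUnit L) (imagUnit_ne_zero L)
      (imagUnit_mul_self L) (gram (Fp L) e (realDiagonal L dV hdV) TW') (isSymm_gram (Fp L) e (realDiagonal_isSymm L dV hdV) hW')
      (J := Matrix.reindex e e (Matrix.diagonal dV ⊗ₖ JW'))
      (reindex_kronecker_eq_gram_map (Fp L) L e (realDiagonal_map L dV hdV).symm hJW') := by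
  subst hT hJ
  exact 𝓢

set_option maxHeartbeats 2000000 in
/-- **the square, read on the consumers' Gram data**: for `realDiagonal dW = T_W'`, `diagonal dW = J_W'`, the TRANSPORTED undoubled
splitting `splittingCongr hT hJ (undoubleHom (assemble (finHalf 𝓕) sa))` of `U(diag dV ⊗ J_W')(𝔸)` restricted to the finite-adelic pair
IS the reference section of the transported local undoublings `congrW hT hJ (undoubledSplittings 𝓕)`.
[cite: GelbartRogawski1991, §3.1 Prop. 3.1.1 p. 455 L1–3, Remark p. 457 L4–13] -/
theorem pairSmall₁_splittingCongr_undoubleHom_assemble_eq_localRefSection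
    (hT : realDiagonal L dW hdW = TW') (hJ : Matrix.diagonal dW = JW') (hW' : TW'.IsSymm)
    (hJW' : JW' = TW'.map (algebraMap (Fp L) L))
    {sa : UnitaryGroup.arch (Fp L) L (IsCMField.complexConj L) (n + n) (hermD L e dV hdV dW hdW) →* MpD L e dV hdV dW hdW}
    (ha : IsArchHalf L e dV hdV hdV0 dW hdW hdW0 χ sa) :
    (pairSmall₁ (Fp L) L (IsCMField.complexConj L) N M e (Matrix.diagonal dV) JW'
        (Literature.NumberTheory.Automorphic.Liu2021.Def411WeilCarriersDoubling.splittingCongr (Fp L) L (IsCMField.complexConj L) N M e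
          (Matrix.diagonal dV) hT hJ
          (undoubleHom L e dV hdV hdV0 dW hdW hdW0
            (assemble L e dV hdV hdV0 dW hdW hdW0 (finHalf_isFinHalf L e dV hdV hdV0 dW hdW hdW0 χ 𝔪 𝓕) ha)
            (isDoubledWeilRep_assemble L e dV hdV hdV0 dW hdW hdW0 χ
              (finHalf_isFinHalf L e dV hdV hdV0 dW hdW hdW0 χ 𝔪 𝓕) ha).proj_eq))).comp
      (finPairToAdelic (Fp L) L (IsCMField.complexConj L) N M (Matrix.diagonal dV) JW') =
    localRefSection (Fp L) L (IsCMField.complexConj L) N M e (Matrix.diagonal dV) JW'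
      (complexConj_imagUnit L) (imagUnit_ne_zero L) (imagUnit_mul_self L) (realDiagonal_isSymm L dV hdV) hW'
      (realDiagonal_map L dV hdV).symm hJW'
      (congrW L e dV hdV dW hdW hT hJ (undoubledSplittings L e dV hdV hdV0 dW hdW hdW0 χ 𝔪 𝓕) hW' hJW') := by
  subst hT hJ
  exact pairSmall₁_undoubleHom_assemble_finPairToAdelic_eq_localRefSection L e dV hdV hdV0 dW hdW hdW0 χ 𝔪 𝓕 ha

end Transport

end Literature.NumberTheory.GelbartRogawski1991.GRConstruction

end

/-! ### Build-lane note (ops-buildfix G11b-3 recipe v2, LEDGER B13-1/B14-5/B14-7, 2026-08-22)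
`lean -o` (the hub build lane, never `lean`/the gate check) runs Lean 4.32's library-suggestion indexers
(`Lean.LibrarySuggestions.SymbolFrequency` / `SineQuaNon`, from their `exportEntriesFn`) over the statement of every local
theorem constant that is not a denied premise; on this family's statements (very large dependent binder telescopes) that fold
runs for many minutes (incident G11b-3, run/shared/lean/ops/buildfix/G11b-3-DOSSIER.md; this file: child `lean -o` 1392 s,
in-file census 10 constants, proxy 1.3e+12). `isDeniedPremise` skips `[implicit_reducible]` constants before any fold, and the
status is inert on theorems (Meta never unfolds `thmInfo`). v2 form: ONE file-final, top-level `local` attribute — synchronous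
scoped reducibility extension, read first by `getReducibilityStatusCore`, never popped before export, not exported, no
`Elab.async false` needed; it also covers auto-realized `*.congr_simp` / structure-projection theorem constants.
No statement or proof is changed. -/
set_option allowUnsafeReducibility true in
attribute [local implicit_reducible]
  Literature.NumberTheory.GelbartRogawski1991.GRConstruction.pairSmall₁_splittingCongr_undoubleHom_assemble_eq_localRefSection
  Literature.NumberTheory.GelbartRogawski1991.GRConstruction.pairSmall₁_undoubleHom_assemble_finPairToAdelic_eq_localRefSection
  Literature.NumberTheory.GelbartRogawski1991.GRConstruction.pairSmall₁_undoubleHom_eq_localRefSection_of_productFormula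
  Literature.NumberTheory.GelbartRogawski1991.GRConstruction.pairSmall₁_undoubleHom_finPairToAdelic_eq_localRefSection
  Literature.NumberTheory.GelbartRogawski1991.GRConstruction.omega_undouble_stdVec
  Literature.NumberTheory.GelbartRogawski1991.GRConstruction.isDoubledWeilRep_assemble
  Literature.NumberTheory.GelbartRogawski1991.GRConstruction.productFormula_of_finHalf
  Literature.NumberTheory.GelbartRogawski1991.GRConstruction.stdVec_ne_zero
  Literature.NumberTheory.GelbartRogawski1991.GRConstruction.stdVec_apply_zero
  Literature.NumberTheory.GelbartRogawski1991.GRConstruction.piProd_baseFamily_zero
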